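import Summits.BirchSwinnertonDyer.BirchSwinnertonDyer.Theorems.PrintCf2SplitBadTwoLineDoubleCoset
import Summits.BirchSwinnertonDyer.BirchSwinnertonDyer.Theorems.PrintCf2SplitBadTwoLineResLocalDefectSevenModEight
import Summits.BirchSwinnertonDyer.BirchSwinnertonDyer.Theorems.PrintCf2SplitBadTwoLocalControlKernelInertia
import Summits.BirchSwinnertonDyer.BirchSwinnertonDyer.Theorems.PrintCf2SplitBadTwoFirstLayerRamifiedAtVbar
import HarnessLib

/-!
# Crux `PrintCf2.SplitBadTwoRankOneOfFacts` (stmt-BirchSwinnertonDyer-20368), road α v12/v13, stub S3d — the σ-BOOKKEEPING brick (DC), part 2: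
# ROAD-α FRAMES — the ramification witness, Agboola's strictness at `2^m` conjugates, and CLASS (i): an inertial sign-mover makes `Def` and
# `S_{W*}(K*_∞)/𝔖` finite

Cell `bsd-print-cf2`, EXTRA WIDTH seat `bsd-line-cf2-p1-w8` g4 (prover-bsd-line-cf2-p1-w8-g4-0); `--supports stmt-BirchSwinnertonDyer-20368`
(helper, Theses-free). Sequel of `PrintCf2SplitBadTwoLineDoubleCoset.lean` ((DC-1)–(DC-4) generic). HONEST FRAMING: nothing here closes the crux or a
registered stub; BSD is not proved by any of this; no summit `Statement.lean` is touched; no `sorry`, no new axiom, no Literature fact, no definition.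

Notation: `K` imaginary quadratic, `2 = v v̄`, `W* = ↥((W.baseChange K).endEigenPrimaryTorsion 2 π r)` (the summand pinned at `v`), `κ'` THE `ℤ₂`-line of `K`
unramified outside `v̄` (`K*_∞ = K̄^{ker κ'}`), `γ'` a topological generator, `S_{W*}(K*_∞) = KellerYin2024.unrSelmer κ' W* v̄ ∅ = datumSelmer (ker κ') W* 2
(bdpData W* 2 v̄) ∅` (unramified above `v̄`), `𝔖 = 𝔖_v̄(K*_∞, W*) = restrictedSelmerZp κ' W* v̄` (strict above `v̄`), and -w6 g4's local defect group
`Def(κ', W*, v̄) = ker (H¹(ker κ' ⊓ D_v̄, W*) → H¹(ker κ' ⊓ I_v̄, W*))` (STATUS 2026-08-29T02:44:26Z).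

* `exists_mem_inertia_apply_ne_one_of_isUnramifiedOutside` — the line is RAMIFIED at the chosen prime above `v̄` (-w5 g4), any `p`.
* `mem_restrictedSelmerZp_iff_forall_lt_of_frame` — **(DC-3) on road α**: for `c ∈ S_{W*}(K*_∞)`, `c ∈ 𝔖 ↔ ∀ n < 2^m, res_{ker κ' ⊓ D_v̄}(conj_{γ'ⁿ} c) = 0`
  (`m` = valuation of `κ' τ₁` for ANY ramified inertia witness `τ₁`; -w6 g4's `awayKer_eq_unramifiedKer_of_frame` away from `2`).
* `finite_localDefect_vbar_of_inertial_mover_of_frame` — **(DC-4a)**: `Def` is FINITE when some `τ₀ ∈ I_v̄ ∩ ker κ'` acts on `W*` as `−1` (class (i)).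
* `finite_localDefect_of_inertial_mover_of_frame` — **(DC-4)**: then `Q = S_{W*}(K*_∞) ⧸ 𝔖` is FINITE — -w3 g11's `hQ` of
  `StrictDefect.hasCharValuationAt_restricted_of_unr_of_finite` (`e_δ = 0` on those frames) and, definitionally, -w6 g4's `LineTransport.finite_localDefect_iff` RHS.

[cite: GreenbergVatsal2000, §2 pp. 16–17, 20–21] [cite: Agboola2007, §3 Prop. 3.2 (arXiv p0008:L58–80)] [cite: GreenbergLNM1716, §3 Lemma 3.3 (p. 87)]
[cite: NeukirchANT1999, Ch. I §9] [cite: Rubin1999, §3 Lemma 3.6 (ii)]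
-/

noncomputable section

set_option linter.dupNamespace false
set_option autoImplicit false

open scoped Classical

open NumberField IsDedekindDomain Field
open Literature.NumberTheory.EllipticCurves Literature.NumberTheory.EllipticCurves.GreenbergSelmer
open Literature.NumberTheory.GaloisRepresentations
open Summit.BirchSwinnertonDyer.BirchSwinnertonDyer.Theorems.AnomalousLocalTorsion

universe u

namespace Summit.BirchSwinnertonDyer.BirchSwinnertonDyer.Theorems.PrintCf2.LineDoubleCoset

/-! ## §4b. TOTALLY RAMIFIED lines: the chosen place ALONE decides, and `S_M(K_∞)/𝔖 ↪ Def` (one prime above `v̄`) -/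

section TotallyRamified

open Literature.NumberTheory.EllipticCurves.Agboola2007 Literature.NumberTheory.EllipticCurves.GreenbergVatsal2000

variable {K : Type} [Field K] [NumberField K] {p : ℕ} [Fact p.Prime] (κ : ZpExtension K p)
  (M : Type) [AddCommGroup M] [DistribMulAction (absoluteGaloisGroup K) M] [TopologicalSpace M] [DiscreteTopology M]

/-- **(DC-1u) Total ramification: `Γ_K = I_w · ker κ`.** If some `τ₁ ∈ I_w` has `κ τ₁` a UNIT of `ℤ_p` (i.e. `κ(I_w) = ℤ_p`: ONE prime of `K_∞`
above `w`), every `σ ∈ Γ_K` is `τ · h` with `τ ∈ I_w`, `h ∈ ker κ` (`ℤ_p`-saturation of the image of the closed subgroup `I_w`).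
[cite: Washington1997, §13.1] [cite: NeukirchANT1999, Ch. I §9] -/
theorem exists_eq_inertia_mul_of_isUnit {w : HeightOneSpectrum (𝓞 K)} {τ₁ : absoluteGaloisGroup K}
    (hτ₁ : τ₁ ∈ GreenbergSelmer.inertia w) (hu : IsUnit (κ τ₁).toAdd) (σ : absoluteGaloisGroup K) :
    ∃ (τ : absoluteGaloisGroup K) (h : absoluteGaloisGroup K), τ ∈ GreenbergSelmer.inertia w ∧ h ∈ κ.kerSubgroup ∧ σ = τ * h := by
  obtain ⟨u, hu⟩ := hu
  obtain ⟨τ, hτI, hτ⟩ := exists_mem_apply_eq_ofAdd_mul κ (GreenbergSelmer.inertia w) (isClosed_inertia' w) hτ₁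
    ((κ σ).toAdd * ((u⁻¹ : ℤ_[p]ˣ) : ℤ_[p]))
  refine ⟨τ, τ⁻¹ * σ, hτI, ?_, by group⟩
  rw [ZpExtension.mem_kerSubgroup, map_mul, map_inv, hτ, ← hu, mul_assoc, Units.inv_mul, mul_one, ofAdd_toAdd, inv_mul_cancel]

/-- **(DC-3₀u) For a totally ramified line the chosen place ALONE decides**: if `κ τ₁` is a unit for some `τ₁ ∈ I_w`, then for every
`s ∈ H¹(Gal(K̄/K_∞), M)`: `(∀ σ, res_{ker κ ⊓ D_w}(conj_σ s) = 0) ↔ res_{ker κ ⊓ D_w} s = 0`. [cite: NeukirchANT1999, Ch. I §9] [cite: SerreGaloisCohomology1997, I §2.5] -/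
theorem forall_resOfLe_conjH1_eq_zero_iff_of_isUnit {w : HeightOneSpectrum (𝓞 K)} {τ₁ : absoluteGaloisGroup K}
    (hτ₁ : τ₁ ∈ GreenbergSelmer.inertia w) (hu : IsUnit (κ τ₁).toAdd) (s : subgroupH1 κ.kerSubgroup M) :
    (∀ σ : absoluteGaloisGroup K,
        resOfLe M (inf_le_left : κ.kerSubgroup ⊓ decomp w ≤ κ.kerSubgroup) (conjH1 κ.kerSubgroup M σ s) = 0) ↔
      resOfLe M (inf_le_left : κ.kerSubgroup ⊓ decomp w ≤ κ.kerSubgroup) s = 0 := by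
  refine ⟨fun h ↦ ?_, fun h σ ↦ ?_⟩
  · have h0 := h 1
    rwa [conjH1_one_holds κ.kerSubgroup M, AddMonoidHom.id_apply] at h0
  · obtain ⟨τ, h', hτ, hh', rfl⟩ := exists_eq_inertia_mul_of_isUnit κ hτ₁ hu σ
    rw [conjH1_mul_holds κ.kerSubgroup M, AddMonoidHom.comp_apply, conjH1_of_mem_holds κ.kerSubgroup M hh', AddMonoidHom.id_apply,
      resOfLe_inf_conjH1_eq_zero_iff_of_mem M κ.kerSubgroup (decomp w) (GreenbergSelmer.inertia_le_decomp w hτ)]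
    exact h

/-- **(DC-3u) AGBOOLA'S STRICTNESS AT THE CHOSEN PLACE, totally ramified line.** `K` totally complex, `awayKer = unramifiedKer` away from `p`
over the line, and `κ(I_v̄) = ℤ_p` (a unit value on inertia): a class `c` of the unramified group `S_M(K_∞)` lies in `𝔖_v̄(K_∞, M)` iff
`res_{ker κ ⊓ D_v̄} c = 0`. [cite: Agboola2007, §3 (arXiv p0008:L58–80)] [cite: GreenbergVatsal2000, §2 p. 17] -/
theorem mem_restrictedSelmerZp_iff_resOfLe_eq_zero [IsTotallyComplex K] {vbar : HeightOneSpectrum (𝓞 K)}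
    (haway : ∀ w : HeightOneSpectrum (𝓞 K), ((p : ℕ) : 𝓞 K) ∉ w.asIdeal →
      GreenbergSelmer.awayKer κ.kerSubgroup M w = unramifiedKer κ.kerSubgroup M w)
    {τ₁ : absoluteGaloisGroup K} (hτ₁ : τ₁ ∈ GreenbergSelmer.inertia vbar) (hu : IsUnit (κ τ₁).toAdd)
    {c : subgroupH1 κ.kerSubgroup M} (hc : c ∈ datumSelmer κ.kerSubgroup M p (Castella2018.AcSelmer.bdpData M p vbar) ∅) :
    c ∈ restrictedSelmerZp κ M vbar ↔ resOfLe M (inf_le_left : κ.kerSubgroup ⊓ decomp vbar ≤ κ.kerSubgroup) c = 0 := by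
  rw [← forall_resOfLe_conjH1_eq_zero_iff_of_isUnit κ M hτ₁ hu c, restrictedSelmerZp_eq, Castella2018.AcSelmer.mem_selmerOver_iff]
  rw [mem_datumSelmer_iff, mem_unramifiedOutside_iff] at hc
  constructor
  · rintro ⟨-, -, hstr⟩ σ
    have h := hstr σ
    rwa [BigGaloisRep.strictKer_strictDatum_eq_awayKer, GreenbergSelmer.awayKer, AddMonoidHom.mem_ker] at h
  · intro h
    refine ⟨fun w hw _ σ ↦ ?_, fun w σ ↦ BigGaloisRep.mem_infKer_of_isComplex _ _ (IsTotallyComplex.isComplex w) _, fun σ ↦ ?_⟩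
    · rw [haway w hw]
      exact hc.1 w (Set.notMem_empty w) hw σ
    · rw [BigGaloisRep.strictKer_strictDatum_eq_awayKer, GreenbergSelmer.awayKer, AddMonoidHom.mem_ker]
      exact h σ

/-- **(DC-5) `S_M(K_∞) ⧸ 𝔖_v̄(K_∞, M)` EMBEDS IN `Def(κ, M, v̄)` for a totally ramified line** (one prime of `K_∞` above `v̄`): the restriction to the
chosen place `c ↦ res_{ker κ ⊓ D_v̄} c` induces an INJECTIVE additive map `j : S_M(K_∞) ⧸ 𝔖 →+ Def` with `j [c] = res c` — the injectivity half of
Greenberg–Vatsal's `S^{Σ₀}/S ≅ ∏ 𝓗_ℓ`, here with a single local factor. [cite: GreenbergVatsal2000, §2 pp. 17, 20–21 (Cor. 2.3)] [cite: Agboola2007, §3 Prop. 3.2] -/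
theorem exists_injective_toLocalDefect [IsTotallyComplex K] {vbar : HeightOneSpectrum (𝓞 K)} (hvbar : ((p : ℕ) : 𝓞 K) ∈ vbar.asIdeal)
    (haway : ∀ w : HeightOneSpectrum (𝓞 K), ((p : ℕ) : 𝓞 K) ∉ w.asIdeal →
      GreenbergSelmer.awayKer κ.kerSubgroup M w = unramifiedKer κ.kerSubgroup M w)
    {τ₁ : absoluteGaloisGroup K} (hτ₁ : τ₁ ∈ GreenbergSelmer.inertia vbar) (hu : IsUnit (κ τ₁).toAdd) :
    ∃ j : (↥(KellerYin2024.unrSelmer κ M vbar ∅) ⧸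
        (restrictedSelmerZp κ M vbar).addSubgroupOf (KellerYin2024.unrSelmer κ M vbar ∅)) →+
      ↥(resOfLe M (inf_le_inf_left κ.kerSubgroup (GreenbergSelmer.inertia_le_decomp vbar) :
          κ.kerSubgroup ⊓ GreenbergSelmer.inertia vbar ≤ κ.kerSubgroup ⊓ decomp vbar)).ker,
      Function.Injective j ∧
        ∀ c : ↥(KellerYin2024.unrSelmer κ M vbar ∅),
          ((j (QuotientAddGroup.mk c) : ↥(resOfLe M (inf_le_inf_left κ.kerSubgroup (GreenbergSelmer.inertia_le_decomp vbar) :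
              κ.kerSubgroup ⊓ GreenbergSelmer.inertia vbar ≤ κ.kerSubgroup ⊓ decomp vbar)).ker) : subgroupH1 (κ.kerSubgroup ⊓ decomp vbar) M) =
            resOfLe M (inf_le_left : κ.kerSubgroup ⊓ decomp vbar ≤ κ.kerSubgroup) (c : subgroupH1 κ.kerSubgroup M) := by
  have hmemS : ∀ c : ↥(KellerYin2024.unrSelmer κ M vbar ∅),
      (c : subgroupH1 κ.kerSubgroup M) ∈ datumSelmer κ.kerSubgroup M p (Castella2018.AcSelmer.bdpData M p vbar) ∅ := fun c ↦ c.2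
  have hmem1 : ∀ c : ↥(KellerYin2024.unrSelmer κ M vbar ∅),
      resOfLe M (inf_le_left : κ.kerSubgroup ⊓ decomp vbar ≤ κ.kerSubgroup) (c : subgroupH1 κ.kerSubgroup M) ∈
        (resOfLe M (inf_le_inf_left κ.kerSubgroup (GreenbergSelmer.inertia_le_decomp vbar) :
          κ.kerSubgroup ⊓ GreenbergSelmer.inertia vbar ≤ κ.kerSubgroup ⊓ decomp vbar)).ker := by
    intro c
    have h := resOfLe_conjH1_mem_localDefect_of_mem_datumSelmer κ M hvbar (hmemS c) 1
    rwa [conjH1_one_holds κ.kerSubgroup M, AddMonoidHom.id_apply] at h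
  let f : ↥(KellerYin2024.unrSelmer κ M vbar ∅) →+
      ↥(resOfLe M (inf_le_inf_left κ.kerSubgroup (GreenbergSelmer.inertia_le_decomp vbar) :
          κ.kerSubgroup ⊓ GreenbergSelmer.inertia vbar ≤ κ.kerSubgroup ⊓ decomp vbar)).ker :=
    { toFun := fun c ↦ ⟨resOfLe M (inf_le_left : κ.kerSubgroup ⊓ decomp vbar ≤ κ.kerSubgroup) (c : subgroupH1 κ.kerSubgroup M), hmem1 c⟩
      map_zero' := Subtype.ext (by simp only [ZeroMemClass.coe_zero, map_zero])
      map_add' := fun a b ↦ Subtype.ext (by simp only [AddSubgroup.coe_add, map_add]) }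
  have hf : ∀ c, ((f c : ↥(resOfLe M (inf_le_inf_left κ.kerSubgroup (GreenbergSelmer.inertia_le_decomp vbar) :
      κ.kerSubgroup ⊓ GreenbergSelmer.inertia vbar ≤ κ.kerSubgroup ⊓ decomp vbar)).ker) : subgroupH1 (κ.kerSubgroup ⊓ decomp vbar) M) =
        resOfLe M (inf_le_left : κ.kerSubgroup ⊓ decomp vbar ≤ κ.kerSubgroup) (c : subgroupH1 κ.kerSubgroup M) := fun _ ↦ rfl
  have hker : (restrictedSelmerZp κ M vbar).addSubgroupOf (KellerYin2024.unrSelmer κ M vbar ∅) ≤ f.ker := by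
    intro c hc
    rw [AddSubgroup.mem_addSubgroupOf] at hc
    rw [AddMonoidHom.mem_ker]
    exact Subtype.ext ((hf c).trans ((mem_restrictedSelmerZp_iff_resOfLe_eq_zero κ M haway hτ₁ hu (hmemS c)).mp hc))
  refine ⟨QuotientAddGroup.lift _ f hker, fun a b hab ↦ ?_, fun c ↦ by rw [QuotientAddGroup.lift_mk _ hker]; exact hf c⟩
  obtain ⟨a, rfl⟩ := QuotientAddGroup.mk_surjective a
  obtain ⟨b, rfl⟩ := QuotientAddGroup.mk_surjective b
  rw [QuotientAddGroup.lift_mk _ hker, QuotientAddGroup.lift_mk _ hker] at hab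
  rw [QuotientAddGroup.eq_iff_sub_mem, AddSubgroup.mem_addSubgroupOf]
  refine (mem_restrictedSelmerZp_iff_resOfLe_eq_zero κ M haway hτ₁ hu (hmemS (a - b))).mpr ?_
  have h : resOfLe M (inf_le_left : κ.kerSubgroup ⊓ decomp vbar ≤ κ.kerSubgroup) (a : subgroupH1 κ.kerSubgroup M) =
      resOfLe M (inf_le_left : κ.kerSubgroup ⊓ decomp vbar ≤ κ.kerSubgroup) (b : subgroupH1 κ.kerSubgroup M) := by
    have h0 := congrArg Subtype.val hab
    rwa [hf, hf] at h0
  rw [AddSubgroupClass.coe_sub, map_sub, sub_eq_zero]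
  exact h

end TotallyRamified

/-! ## §5. Road α frames: the ramification witness, (DC-3), and CLASS (i): an inertial sign-mover makes `Def` and `S_{W*}(K*_∞)/𝔖` finite -/

section Frame

open WeierstrassCurve Literature.NumberTheory.EllipticCurves.Agboola2007 Literature.NumberTheory.EllipticCurves.GreenbergVatsal2000
open Summit.BirchSwinnertonDyer.BirchSwinnertonDyer.Theorems.PrintCf2.AdditiveAtSeven
open Summit.BirchSwinnertonDyer.BirchSwinnertonDyer.Theorems.PrintCf2.CMPrimes
open Summit.BirchSwinnertonDyer.BirchSwinnertonDyer.Theorems.PrintCf2.RestrictedSelmerPair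
open Summit.BirchSwinnertonDyer.BirchSwinnertonDyer.Theorems.PrintCf2.LineLocallyTrivial
open Summit.BirchSwinnertonDyer.BirchSwinnertonDyer.Theorems.PrintCf2.SplitPrimeLine

variable {K : Type} [Field K] [NumberField K]

/-- **The line `κ'` unramified outside `v̄` of an imaginary quadratic `K` is RAMIFIED at the chosen prime above `v̄`**: some `τ₁ ∈ I_v̄` has
`κ' τ₁ ≠ 1` (-w5 g4's `inertia_not_le_kerSubgroup_of_isUnramifiedOutside`, read on `GreenbergSelmer.inertia`). [cite: Washington1997, §13.1 Prop. 13.2]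
[cite: Agboola2007, §1 p. 1] -/
theorem exists_mem_inertia_apply_ne_one_of_isUnramifiedOutside (hK : IsImaginaryQuadratic K) {p : ℕ} [Fact p.Prime]
    {vbar : HeightOneSpectrum (𝓞 K)} (κ' : ZpExtension K p) (hκ' : κ'.IsUnramifiedOutside vbar) :
    ∃ τ₁ ∈ GreenbergSelmer.inertia vbar, κ' τ₁ ≠ 1 := by
  have h := inertia_not_le_kerSubgroup_of_isUnramifiedOutside (p := p) hK hκ' (adicCompletionPrime_mem_primesAbove K vbar)
  rw [inertia_adicCompletionPrime_eq_map_absInertia K vbar] at h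
  obtain ⟨τ₁, hτ₁, hnot⟩ := SetLike.not_le_iff_exists.mp h
  exact ⟨τ₁, hτ₁, fun h1 ↦ hnot (ZpExtension.mem_kerSubgroup.mpr h1)⟩

/-- **Road α: THE line unramified outside `v̄` is TOTALLY RAMIFIED at the chosen prime above `v̄`** — some `τ₁ ∈ I_v̄` has `κ' τ₁ ∈ ℤ₂ˣ`
(ONE prime of `K*_∞` above `v̄`). From -w6 g2's `FirstLayer.not_inertia_vbar_le_layerSubgroup_one_of_frame` (`v̄` ramifies already in the first
layer, Kummer parity on the frame): an inertia element outside `κ'⁻¹(2ℤ₂)` has unit value. [cite: Washington1997, §13.1 Prop. 13.2]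
[cite: Lang1983, Ch. 6 Prop. 1.3] -/
theorem exists_mem_inertia_isUnit_of_frame {d : ℤ} (hd0 : d ≠ 0) (W : WeierstrassCurve ℚ) [W.IsElliptic]
    (C : VariableChange ℚ) (hC : C • W = cm7.quadraticTwist (d : ℚ)) (hK : IsImaginaryQuadratic K)
    {v vbar : HeightOneSpectrum (𝓞 K)} (hv : ((2 : ℕ) : 𝓞 K) ∈ v.asIdeal) (hvbar : ((2 : ℕ) : 𝓞 K) ∈ vbar.asIdeal) (hne : vbar ≠ v)
    (π : (W.baseChange K).endRing) (hrel : (π : AddMonoid.End (W.baseChange K).geomPoints) * π = π - 2)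
    (κ' : ZpExtension K 2) (hκ' : κ'.IsUnramifiedOutside vbar) :
    ∃ τ₁ ∈ GreenbergSelmer.inertia vbar, IsUnit (κ' τ₁).toAdd := by
  haveI : Fact (Nat.Prime 2) := ⟨Nat.prime_two⟩
  have hj : W.j = -3375 := j_eq_of_smul_eq_cm7Twist hd0 W C hC
  obtain ⟨θ, hθ⟩ := exists_sq_eq_neg_seven_of_cmEndo_mem_endRing W K hj π hrel
  have h := FirstLayer.not_inertia_vbar_le_layerSubgroup_one_of_frame hK hθ hd0 W hC hv hvbar hne κ' hκ'
  obtain ⟨τ₁, hτ₁, hnot⟩ := SetLike.not_le_iff_exists.mp h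
  refine ⟨τ₁, hτ₁, PadicInt.isUnit_iff.mpr (le_antisymm (PadicInt.norm_le_one _) (not_lt.mp fun hlt ↦ hnot ?_))⟩
  rw [ZpExtension.mem_layerSubgroup, pow_one]
  exact (PadicInt.norm_lt_one_iff_dvd _).mp hlt

/-- **(DC-3′) ON ROAD α: AGBOOLA'S STRICTNESS AT THE CHOSEN PLACE ALONE.** For `c ∈ S_{W*}(K*_∞)`: `c ∈ 𝔖_v̄(K*_∞, W*) ↔ res_{ker κ' ⊓ D_v̄} c = 0` —
ONE prime of `K*_∞` above `v̄` (total ramification), so no conjugates are needed. [cite: Agboola2007, §3 (arXiv p0008:L58–80)]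
[cite: GreenbergVatsal2000, §2 p. 17] -/
theorem mem_restrictedSelmerZp_iff_resOfLe_eq_zero_of_frame {d : ℤ} (hd0 : d ≠ 0) (W : WeierstrassCurve ℚ) [W.IsElliptic]
    (C : VariableChange ℚ) (hC : C • W = cm7.quadraticTwist (d : ℚ)) (hK : IsImaginaryQuadratic K)
    {v vbar : HeightOneSpectrum (𝓞 K)} (hv : ((2 : ℕ) : 𝓞 K) ∈ v.asIdeal) (hvbar : ((2 : ℕ) : 𝓞 K) ∈ vbar.asIdeal) (hne : vbar ≠ v)
    (π : (W.baseChange K).endRing) (hrel : (π : AddMonoid.End (W.baseChange K).geomPoints) * π = π - 2) (r : ℤ_[2])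
    (κ' : ZpExtension K 2) (hκ' : κ'.IsUnramifiedOutside vbar)
    {c : subgroupH1 κ'.kerSubgroup ↥((W.baseChange K).endEigenPrimaryTorsion 2 π r)}
    (hc : c ∈ datumSelmer κ'.kerSubgroup ↥((W.baseChange K).endEigenPrimaryTorsion 2 π r) 2
      (Castella2018.AcSelmer.bdpData ↥((W.baseChange K).endEigenPrimaryTorsion 2 π r) 2 vbar) ∅) :
    c ∈ restrictedSelmerZp κ' ↥((W.baseChange K).endEigenPrimaryTorsion 2 π r) vbar ↔
      resOfLe ↥((W.baseChange K).endEigenPrimaryTorsion 2 π r) (inf_le_left : κ'.kerSubgroup ⊓ decomp vbar ≤ κ'.kerSubgroup) c = 0 := by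
  haveI : Fact (Nat.Prime 2) := ⟨Nat.prime_two⟩
  haveI : IsTotallyComplex K := hK.2
  obtain ⟨τ₁, hτ₁, hu⟩ := exists_mem_inertia_isUnit_of_frame hd0 W C hC hK hv hvbar hne π hrel κ' hκ'
  exact mem_restrictedSelmerZp_iff_resOfLe_eq_zero κ' _ (fun w hw ↦ awayKer_eq_unramifiedKer_of_frame W hK hv hvbar hne π r κ' hκ' hw) hτ₁ hu hc

/-- **(DC-5) ON ROAD α: `Q = S_{W*}(K*_∞) ⧸ 𝔖_v̄(K*_∞, W*)` EMBEDS IN `Def(κ', W*, v̄)`** by restriction to the chosen place: an INJECTIVE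
`j : Q →+ Def` with `j [c] = res_{ker κ' ⊓ D_v̄} c` — the injectivity half of «Q ≅ 𝓗» with 𝓗 = Def (ONE prime above `v̄`), the input `(j, hj)` of
-w3 g11's `StrictDefect.hasCharValuationAt_restricted_of_unr_of_injective_of_not_finite` and of -w6 g4's S3d assembly.
[cite: GreenbergVatsal2000, §2 pp. 17, 20–21 (Cor. 2.3)] [cite: Agboola2007, §3 Prop. 3.2] -/
theorem exists_injective_toLocalDefect_of_frame {d : ℤ} (hd0 : d ≠ 0) (W : WeierstrassCurve ℚ) [W.IsElliptic]
    (C : VariableChange ℚ) (hC : C • W = cm7.quadraticTwist (d : ℚ)) (hK : IsImaginaryQuadratic K)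
    {v vbar : HeightOneSpectrum (𝓞 K)} (hv : ((2 : ℕ) : 𝓞 K) ∈ v.asIdeal) (hvbar : ((2 : ℕ) : 𝓞 K) ∈ vbar.asIdeal) (hne : vbar ≠ v)
    (π : (W.baseChange K).endRing) (hrel : (π : AddMonoid.End (W.baseChange K).geomPoints) * π = π - 2) (r : ℤ_[2])
    (κ' : ZpExtension K 2) (hκ' : κ'.IsUnramifiedOutside vbar) :
    ∃ j : (↥(KellerYin2024.unrSelmer κ' ↥((W.baseChange K).endEigenPrimaryTorsion 2 π r) vbar ∅) ⧸
        (restrictedSelmerZp κ' ↥((W.baseChange K).endEigenPrimaryTorsion 2 π r) vbar).addSubgroupOf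
          (KellerYin2024.unrSelmer κ' ↥((W.baseChange K).endEigenPrimaryTorsion 2 π r) vbar ∅)) →+
      ↥(resOfLe ↥((W.baseChange K).endEigenPrimaryTorsion 2 π r)
          (inf_le_inf_left κ'.kerSubgroup (GreenbergSelmer.inertia_le_decomp vbar) :
            κ'.kerSubgroup ⊓ GreenbergSelmer.inertia vbar ≤ κ'.kerSubgroup ⊓ decomp vbar)).ker,
      Function.Injective j ∧
        ∀ c : ↥(KellerYin2024.unrSelmer κ' ↥((W.baseChange K).endEigenPrimaryTorsion 2 π r) vbar ∅),
          ((j (QuotientAddGroup.mk c) : ↥(resOfLe ↥((W.baseChange K).endEigenPrimaryTorsion 2 π r)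
              (inf_le_inf_left κ'.kerSubgroup (GreenbergSelmer.inertia_le_decomp vbar) :
                κ'.kerSubgroup ⊓ GreenbergSelmer.inertia vbar ≤ κ'.kerSubgroup ⊓ decomp vbar)).ker) :
              subgroupH1 (κ'.kerSubgroup ⊓ decomp vbar) ↥((W.baseChange K).endEigenPrimaryTorsion 2 π r)) =
            resOfLe ↥((W.baseChange K).endEigenPrimaryTorsion 2 π r) (inf_le_left : κ'.kerSubgroup ⊓ decomp vbar ≤ κ'.kerSubgroup)
              (c : subgroupH1 κ'.kerSubgroup ↥((W.baseChange K).endEigenPrimaryTorsion 2 π r)) := by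
  haveI : Fact (Nat.Prime 2) := ⟨Nat.prime_two⟩
  haveI : IsTotallyComplex K := hK.2
  obtain ⟨τ₁, hτ₁, hu⟩ := exists_mem_inertia_isUnit_of_frame hd0 W C hC hK hv hvbar hne π hrel κ' hκ'
  exact exists_injective_toLocalDefect κ' _ hvbar (fun w hw ↦ awayKer_eq_unramifiedKer_of_frame W hK hv hvbar hne π r κ' hκ' hw) hτ₁ hu

/-- **(DC-3) ON ROAD α.** `K` imaginary quadratic with `2 = v v̄`, `W* = ↥((W.baseChange K).endEigenPrimaryTorsion 2 π r)`, `κ'` the `ℤ₂`-line unramified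
outside `v̄` with topological generator `γ'`, `τ₁ ∈ I_v̄` a ramification witness (valuation `m`): for `c ∈ S_{W*}(K*_∞)`,
`c ∈ 𝔖_v̄(K*_∞, W*) ↔ ∀ n < 2^m, res_{ker κ' ⊓ D_v̄}(conj_{γ'ⁿ} c) = 0`. [cite: Agboola2007, §3 (arXiv p0008:L58–80)] [cite: GreenbergVatsal2000, §2 p. 17] -/
theorem mem_restrictedSelmerZp_iff_forall_lt_of_frame (W : WeierstrassCurve ℚ) (hK : IsImaginaryQuadratic K)
    {v vbar : HeightOneSpectrum (𝓞 K)} (hv : ((2 : ℕ) : 𝓞 K) ∈ v.asIdeal) (hvbar : ((2 : ℕ) : 𝓞 K) ∈ vbar.asIdeal) (hne : vbar ≠ v)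
    (π : (W.baseChange K).endRing) (r : ℤ_[2]) (κ' : ZpExtension K 2) (hκ' : κ'.IsUnramifiedOutside vbar)
    {γ' : absoluteGaloisGroup K} (hγ' : κ'.IsTopGenerator γ') {τ₁ : absoluteGaloisGroup K} (hτ₁ : τ₁ ∈ GreenbergSelmer.inertia vbar)
    (hne₁ : κ' τ₁ ≠ 1) {c : subgroupH1 κ'.kerSubgroup ↥((W.baseChange K).endEigenPrimaryTorsion 2 π r)}
    (hc : c ∈ datumSelmer κ'.kerSubgroup ↥((W.baseChange K).endEigenPrimaryTorsion 2 π r) 2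
      (Castella2018.AcSelmer.bdpData ↥((W.baseChange K).endEigenPrimaryTorsion 2 π r) 2 vbar) ∅) :
    c ∈ restrictedSelmerZp κ' ↥((W.baseChange K).endEigenPrimaryTorsion 2 π r) vbar ↔
      ∀ n : ℕ, n < 2 ^ ((κ' τ₁).toAdd).valuation →
        resOfLe ↥((W.baseChange K).endEigenPrimaryTorsion 2 π r) (inf_le_left : κ'.kerSubgroup ⊓ decomp vbar ≤ κ'.kerSubgroup)
          (conjH1 κ'.kerSubgroup ↥((W.baseChange K).endEigenPrimaryTorsion 2 π r) (γ' ^ n) c) = 0 := by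
  haveI : Fact (Nat.Prime 2) := ⟨Nat.prime_two⟩
  haveI : IsTotallyComplex K := hK.2
  exact mem_restrictedSelmerZp_iff_forall_lt κ' _ (fun w hw ↦ awayKer_eq_unramifiedKer_of_frame W hK hv hvbar hne π r κ' hκ' hw)
    hγ' hτ₁ hne₁ hc

/-- **(DC-4a) CLASS (i): the local defect group at `v̄` is FINITE when an inertial element of the line acts as `−1`.** On a road-α frame (member
`C • W = cm7^{(d)}`, `K` imaginary quadratic, `π² = π − 2`, `r² = r − 2`, `κ'` the line unramified outside `v̄`), if some `τ₀ ∈ I_v̄ ∩ Gal(K̄/K*_∞)` acts on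
`W*` as `−1`, then `Def(κ', W*, v̄) = ker (H¹(ker κ' ⊓ D_v̄, W*) → H¹(ker κ' ⊓ I_v̄, W*))` is finite: transported to `G = D_v̄ ⊓ ker κ'` it embeds in
`(W*)^{I''}/(φ₀ − 1)` for a topological generator `φ₀` of `G/I''` (bsd-eis `exists_generator_decomp_inf_kerSubgroup`, `ResKernel.finite_subgroupResKer`),
and `(W*)^{I''} ⊆ W*[2]` has at most two elements (`τ₀ ∈ I''`). [cite: GreenbergLNM1716, §3 Lemma 3.3 (p. 87)] [cite: GreenbergVatsal2000, §2 p. 17]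
[cite: Rubin1999, §3 Lemma 3.6 (ii)] -/
theorem finite_localDefect_vbar_of_inertial_mover_of_frame {d : ℤ} (hd0 : d ≠ 0) (W : WeierstrassCurve ℚ) [W.IsElliptic]
    (C : VariableChange ℚ) (hC : C • W = cm7.quadraticTwist (d : ℚ)) (hK : IsImaginaryQuadratic K) {vbar : HeightOneSpectrum (𝓞 K)}
    (π : (W.baseChange K).endRing) (hrel : (π : AddMonoid.End (W.baseChange K).geomPoints) * π = π - 2) {r : ℤ_[2]} (hr : r * r = r - 2)
    (κ' : ZpExtension K 2) (hκ' : κ'.IsUnramifiedOutside vbar)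
    {τ₀ : absoluteGaloisGroup K} (hτ₀I : τ₀ ∈ GreenbergSelmer.inertia vbar) (hτ₀κ : τ₀ ∈ κ'.kerSubgroup)
    (hτ₀ : ∀ x : ↥((W.baseChange K).endEigenPrimaryTorsion 2 π r), τ₀ • x = -x) :
    Finite ↥(resOfLe ↥((W.baseChange K).endEigenPrimaryTorsion 2 π r)
        (inf_le_inf_left κ'.kerSubgroup (GreenbergSelmer.inertia_le_decomp vbar) :
          κ'.kerSubgroup ⊓ GreenbergSelmer.inertia vbar ≤ κ'.kerSubgroup ⊓ decomp vbar)).ker := by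
  haveI : Fact (Nat.Prime 2) := ⟨Nat.prime_two⟩
  have hj : W.j = -3375 := j_eq_of_smul_eq_cm7Twist hd0 W C hC
  obtain ⟨θ, hθ⟩ := exists_sq_eq_neg_seven_of_cmEndo_mem_endRing W K hj π hrel
  obtain ⟨τ₁, hτ₁, hne₁⟩ := exists_mem_inertia_apply_ne_one_of_isUnramifiedOutside hK κ' hκ'
  -- the local group `G = D_v̄ ⊓ ker κ'`, its inertia subgroup `N`, a topological generator `φ₀` of `G/N`
  haveI hNn : ((GreenbergSelmer.inertia vbar).subgroupOf (decomp vbar ⊓ κ'.kerSubgroup)).Normal :=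
    normal_inertia_subgroupOf vbar (inf_le_left : decomp vbar ⊓ κ'.kerSubgroup ≤ decomp vbar)
  obtain ⟨σK, hσK⟩ := IsDedekindDomain.HeightOneSpectrum.exists_isArithFrobAt_of_mem_primesAbove_holds (K := K) (v := vbar)
    (adicCompletionPrime_mem_primesAbove K vbar)
  obtain ⟨φ₀, hgen⟩ := exists_generator_decomp_inf_kerSubgroup κ' hσK ⟨τ₁, hτ₁, hne₁⟩
  have hcont : ∀ x : ↥((W.baseChange K).endEigenPrimaryTorsion 2 π r), Continuous fun g : ↥(decomp vbar ⊓ κ'.kerSubgroup) ↦ g • x :=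
    fun x ↦ (continuous_smul_endEigenPrimaryTorsion (W.baseChange K) 2 π r x).comp continuous_subtype_val
  -- `M^N ⊆ W*[2]` is finite (the mover `τ₀ ∈ N` acts as `−1`), hence so is `M^N/(φ₀ − 1)` and the restriction kernel on `G`
  have h2fin : Set.Finite {x : ↥((W.baseChange K).endEigenPrimaryTorsion 2 π r) | (2 : ℕ) • x = 0} := by
    by_cases hex : ∃ x : ↥((W.baseChange K).endEigenPrimaryTorsion 2 π r), x ≠ 0 ∧ (2 : ℕ) • x = 0
    · obtain ⟨x₁, hx₁0, hx₁⟩ := hex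
      refine ((Set.finite_singleton x₁).insert 0).subset fun x hx ↦ ?_
      by_cases hx0 : x = 0
      · exact Set.mem_insert_iff.mpr (Or.inl hx0)
      · exact Set.mem_insert_iff.mpr (Or.inr (Set.mem_singleton_iff.mpr
          (eq_of_two_nsmul_eq_zero_endEigenPrimaryTorsion W hj hθ π hrel hr x x₁ hx hx₁ hx0 hx₁0)))
    · refine (Set.finite_singleton (0 : ↥((W.baseChange K).endEigenPrimaryTorsion 2 π r))).subset fun x hx ↦ ?_
      by_contra hx0
      exact hex ⟨x, hx0, hx⟩
  have hτ₀N : (⟨τ₀, Subgroup.mem_inf.mpr ⟨GreenbergSelmer.inertia_le_decomp vbar hτ₀I, hτ₀κ⟩⟩ : ↥(decomp vbar ⊓ κ'.kerSubgroup)) ∈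
      (GreenbergSelmer.inertia vbar).subgroupOf (decomp vbar ⊓ κ'.kerSubgroup) :=
    Subgroup.mem_subgroupOf.mpr hτ₀I
  have hFixsub : ((FixedPoints.addSubgroup ↥((GreenbergSelmer.inertia vbar).subgroupOf (decomp vbar ⊓ κ'.kerSubgroup))
        ↥((W.baseChange K).endEigenPrimaryTorsion 2 π r) : AddSubgroup _) : Set ↥((W.baseChange K).endEigenPrimaryTorsion 2 π r)) ⊆
      {x | (2 : ℕ) • x = 0} := by
    intro x hx
    have hfix : (⟨_, hτ₀N⟩ : ↥((GreenbergSelmer.inertia vbar).subgroupOf (decomp vbar ⊓ κ'.kerSubgroup))) • x = x :=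
      (FixedPoints.mem_addSubgroup _ _ x).mp hx ⟨_, hτ₀N⟩
    change τ₀ • x = x at hfix
    rw [hτ₀ x] at hfix
    show (2 : ℕ) • x = 0
    rw [two_nsmul]
    nth_rewrite 1 [← hfix]
    exact neg_add_cancel x
  haveI : Finite (FixedPoints.addSubgroup ↥((GreenbergSelmer.inertia vbar).subgroupOf (decomp vbar ⊓ κ'.kerSubgroup))
      ↥((W.baseChange K).endEigenPrimaryTorsion 2 π r)) := (h2fin.subset hFixsub).to_subtype
  haveI : Finite (FixedPoints.addSubgroup ↥((GreenbergSelmer.inertia vbar).subgroupOf (decomp vbar ⊓ κ'.kerSubgroup))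
        ↥((W.baseChange K).endEigenPrimaryTorsion 2 π r) ⧸
      (ResKernel.subOne ((GreenbergSelmer.inertia vbar).subgroupOf (decomp vbar ⊓ κ'.kerSubgroup))
        ↥((W.baseChange K).endEigenPrimaryTorsion 2 π r) φ₀).range) :=
    Finite.of_surjective _ (QuotientAddGroup.mk'_surjective _)
  haveI : Finite (subgroupResKer ↥((W.baseChange K).endEigenPrimaryTorsion 2 π r)
      ((GreenbergSelmer.inertia vbar).subgroupOf (decomp vbar ⊓ κ'.kerSubgroup))) :=
    (ResKernel.finite_subgroupResKer _ _ φ₀ hgen hcont).1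
  -- transport `Def ↪ subgroupResKer` along the restriction `H¹(ker κ' ⊓ D_v̄) → H¹(D_v̄ ⊓ ker κ')` (an isomorphism: the groups coincide)
  have hle : decomp vbar ⊓ κ'.kerSubgroup ≤ κ'.kerSubgroup ⊓ decomp vbar := le_of_eq (inf_comm (decomp vbar) κ'.kerSubgroup)
  have hle' : κ'.kerSubgroup ⊓ decomp vbar ≤ decomp vbar ⊓ κ'.kerSubgroup := le_of_eq (inf_comm κ'.kerSubgroup (decomp vbar))
  let j : ↥((GreenbergSelmer.inertia vbar).subgroupOf (decomp vbar ⊓ κ'.kerSubgroup)) →ₜ* ↥(κ'.kerSubgroup ⊓ GreenbergSelmer.inertia vbar) :=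
    { toFun := fun x ↦ ⟨((x : ↥(decomp vbar ⊓ κ'.kerSubgroup)) : absoluteGaloisGroup K),
        ⟨(x : ↥(decomp vbar ⊓ κ'.kerSubgroup)).2.2, Subgroup.mem_subgroupOf.mp x.2⟩⟩
      map_one' := rfl
      map_mul' := fun _ _ ↦ rfl
      continuous_toFun := (continuous_subtype_val.comp continuous_subtype_val).subtype_mk _ }
  have hcomp : (resH1Hom j (AddMonoidHom.id ↥((W.baseChange K).endEigenPrimaryTorsion 2 π r)) (fun _ _ ↦ rfl)).comp
      (resOfLe ↥((W.baseChange K).endEigenPrimaryTorsion 2 π r) (inf_le_inf_left κ'.kerSubgroup (GreenbergSelmer.inertia_le_decomp vbar) :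
        κ'.kerSubgroup ⊓ GreenbergSelmer.inertia vbar ≤ κ'.kerSubgroup ⊓ decomp vbar)) =
      (ResKernel.resSubgroup ((GreenbergSelmer.inertia vbar).subgroupOf (decomp vbar ⊓ κ'.kerSubgroup))
        ↥((W.baseChange K).endEigenPrimaryTorsion 2 π r)).comp (resOfLe ↥((W.baseChange K).endEigenPrimaryTorsion 2 π r) hle) := by
    unfold Literature.NumberTheory.EllipticCurves.resOfLe ResKernel.resSubgroup
    rw [resH1Hom_comp, resH1Hom_comp]
    exact resH1Hom_congr (ContinuousMonoidHom.ext fun _ ↦ rfl) (AddMonoidHom.ext fun _ ↦ rfl) _ _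
  have hinj : Function.Injective (resOfLe ↥((W.baseChange K).endEigenPrimaryTorsion 2 π r) hle) := by
    intro a b hab
    have h := congrArg (resOfLe ↥((W.baseChange K).endEigenPrimaryTorsion 2 π r) hle') hab
    rwa [← AddMonoidHom.comp_apply, ← AddMonoidHom.comp_apply, Literature.NumberTheory.EllipticCurves.resOfLe_comp_holds,
      Literature.NumberTheory.EllipticCurves.resOfLe_refl_holds, AddMonoidHom.id_apply, AddMonoidHom.id_apply] at h
  refine Finite.of_injective (fun c : ↥(resOfLe ↥((W.baseChange K).endEigenPrimaryTorsion 2 π r)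
      (inf_le_inf_left κ'.kerSubgroup (GreenbergSelmer.inertia_le_decomp vbar) :
        κ'.kerSubgroup ⊓ GreenbergSelmer.inertia vbar ≤ κ'.kerSubgroup ⊓ decomp vbar)).ker ↦
      (⟨resOfLe ↥((W.baseChange K).endEigenPrimaryTorsion 2 π r) hle (c : subgroupH1 (κ'.kerSubgroup ⊓ decomp vbar) _), ?_⟩ :
        ↥(subgroupResKer ↥((W.baseChange K).endEigenPrimaryTorsion 2 π r)
          ((GreenbergSelmer.inertia vbar).subgroupOf (decomp vbar ⊓ κ'.kerSubgroup)))))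
    fun a b hab ↦ Subtype.ext (hinj (congrArg Subtype.val hab))
  rw [ResKernel.mem_subgroupResKer_iff, ← AddMonoidHom.comp_apply, ← hcomp, AddMonoidHom.comp_apply, (AddMonoidHom.mem_ker).mp c.2, map_zero]

/-- **(DC-4) CLASS (i) OF S3d: AN INERTIAL SIGN-MOVER MAKES `Q = S_{W*}(K*_∞) ⧸ 𝔖_v̄(K*_∞, W*)` FINITE.** On a road-α frame (member `C • W = cm7^{(d)}`,
`K` imaginary quadratic, `2 = v v̄`, `π² = π − 2`, `r² = r − 2`, `κ'` the line unramified outside `v̄`), if some `τ₀ ∈ I_v̄ ∩ Gal(K̄/K*_∞)` acts on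
`W*` as `−1`, then `Q := ↥(unrSelmer κ' W* v̄ ∅) ⧸ 𝔖_v̄(K*_∞, W*)` is FINITE — -w3 g11's `hQ` in `StrictDefect.hasCharValuationAt_restricted_of_unr_of_finite`
(`e_δ = 0` on those frames) and, definitionally, -w6 g4's `LineTransport.finite_localDefect_iff` right-hand side. [cite: GreenbergVatsal2000, §2 pp. 17, 20–21]
[cite: Agboola2007, §3 Prop. 3.2] [cite: GreenbergLNM1716, §3 Lemma 3.3] -/
theorem finite_localDefect_of_inertial_mover_of_frame {d : ℤ} (hd0 : d ≠ 0) (W : WeierstrassCurve ℚ) [W.IsElliptic]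
    (C : VariableChange ℚ) (hC : C • W = cm7.quadraticTwist (d : ℚ)) (hK : IsImaginaryQuadratic K)
    {v vbar : HeightOneSpectrum (𝓞 K)} (hv : ((2 : ℕ) : 𝓞 K) ∈ v.asIdeal) (hvbar : ((2 : ℕ) : 𝓞 K) ∈ vbar.asIdeal) (hne : vbar ≠ v)
    (π : (W.baseChange K).endRing) (hrel : (π : AddMonoid.End (W.baseChange K).geomPoints) * π = π - 2) {r : ℤ_[2]} (hr : r * r = r - 2)
    (κ' : ZpExtension K 2) (hκ' : κ'.IsUnramifiedOutside vbar)
    {τ₀ : absoluteGaloisGroup K} (hτ₀I : τ₀ ∈ GreenbergSelmer.inertia vbar) (hτ₀κ : τ₀ ∈ κ'.kerSubgroup)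
    (hτ₀ : ∀ x : ↥((W.baseChange K).endEigenPrimaryTorsion 2 π r), τ₀ • x = -x) :
    Finite (↥(KellerYin2024.unrSelmer κ' ↥((W.baseChange K).endEigenPrimaryTorsion 2 π r) vbar ∅) ⧸
      (restrictedSelmerZp κ' ↥((W.baseChange K).endEigenPrimaryTorsion 2 π r) vbar).addSubgroupOf
        (KellerYin2024.unrSelmer κ' ↥((W.baseChange K).endEigenPrimaryTorsion 2 π r) vbar ∅)) := by
  haveI : Fact (Nat.Prime 2) := ⟨Nat.prime_two⟩
  haveI : IsTotallyComplex K := hK.2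
  obtain ⟨γ', hγ'⟩ : ∃ γ' : absoluteGaloisGroup K, κ'.IsTopGenerator γ' := κ'.surjective (Multiplicative.ofAdd 1)
  obtain ⟨τ₁, hτ₁, hne₁⟩ := exists_mem_inertia_apply_ne_one_of_isUnramifiedOutside hK κ' hκ'
  haveI := finite_localDefect_vbar_of_inertial_mover_of_frame hd0 W C hC hK π hrel hr κ' hκ' hτ₀I hτ₀κ hτ₀
  exact finite_localDefect_of_finite_localDefect_vbar κ' _ hvbar
    (fun w hw ↦ awayKer_eq_unramifiedKer_of_frame W hK hv hvbar hne π r κ' hκ' hw) hγ' hτ₁ hne₁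

end Frame

end Summit.BirchSwinnertonDyer.BirchSwinnertonDyer.Theorems.PrintCf2.LineDoubleCoset

end
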